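import Summits.QuantumFields.BalabanUV.Beta.D1BFx.TorusTraceTadpole

/-!
# «tendsto_hessT_hessKer_of_uniform» — TA3's torus → `ℤ^D` Hess limit for k-DEPENDENT vertex∕table families (road «BF-x», slot (K))

Owner ruling ρ-g7-8 (journal l.26338, answering «Q-leaf03-N3»): the N-side table slots of TB5-3 (`KCombine.hessKer_transfer_road_family`)
become k-INDEXED families `𝒱N k`, `𝒲N k` (the dressed gluon tables `Π̂ᵀ𝒱_MΠ̂` and the mixed straight weight jet `ℬ₂` periodise to arrays
of s-dependent `ℤ⁴` kernels — wrap-around through non-local legs), subject to (u1) `BiLoc` constants∕rate UNIFORM in `k` and (u2) ENTRYWISE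
convergence `𝒱N k → 𝒱N∞`, `𝒲N k → 𝒲N∞`.  This file is the ONE new socket the ruling asks for: TA3's `TorusTraceTadpole.tendsto_hessT_hessKer`
with the fixed families replaced by k-dependent ones under (u1)+(u2), the limit being the `ℤ^D` Hessian kernel of the LIMIT families.

PROOF SHAPE (all [folklore]): TA3's torus-vs-`ℤ^D` RATES (`abs_trace_tadpole_sub_tadpole_le`, `abs_trace_bubble_sub_bubble_le`) have `s`-free constants
depending only on the localisation DATA, hence apply verbatim to `W k`, `V k`, `V′ k` under (u1) — the torus functional minus the `ℤ^D` functional OF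
THE k-TH FAMILY is `O(imageTail)` uniformly; and the `ℤ^D` functionals of the k-th family converge to those of the limit family by dominated
convergence (`tendsto_tsum_of_dominated_convergence`, Tannery) against the uniform exponential majorants.
* §1 `ℤ^D` dominated convergence: `tendsto_comp_apply_of_uniform` (fixed decaying leg ∘ uniform family), `tendsto_comp_apply_of_uniform₂`
  (two uniform families), `tendsto_tr_of_uniform`, `tendsto_tadpole_of_uniform`, `tendsto_bubble_of_uniform`, `tendsto_hessKer_of_uniform`.
* §2 torus limits: `tendsto_trace_tadpole_of_uniform`, `tendsto_trace_bubble_of_uniform`, **`tendsto_hessT_hessKer_of_uniform`**.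
No definitions; nothing is asserted beyond the displayed [folklore] analysis.
-/

noncomputable section

namespace Summit.QuantumFields.BalabanUV.Beta.D1BFx.TorusArrayLimitUniform

open Filter Topology
open scoped BigOperators
open Literature.MathematicalPhysics.QuantumFieldTheory.Balaban1983to89
open Literature.MathematicalPhysics.QuantumFieldTheory.Balaban1983to89.Beta
open B12Sec2to5 (l1 l1_nonneg)
open ExpKernelCalculus (Site MKer Decays BiLoc comp tr bubble tadpole hessKer Zl Zl_pos summable_exp_shift summable_exp_shift' biLoc_comp_decays
  biLoc_comp_biLoc abs_trTerm_le exp_mid)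
open KernelWard (bdd_of_decays)
open Summit.QuantumFields.BalabanUV.Beta.TameKernelCalculus (decays_of_le biLoc_of_le)
open Summit.QuantumFields.BalabanUV.Beta.D1BFx.FibredPeriodisation (periodiseF)
open Summit.QuantumFields.BalabanUV.Beta.D1BFx.PeriodicArrays (arr toF)
open Summit.QuantumFields.BalabanUV.Beta.D1BFx.MixedVarPackedHess (hessT)
open Summit.QuantumFields.BalabanUV.Beta.D1BFx.TorusTraceTadpole (abs_trace_tadpole_sub_tadpole_le abs_trace_bubble_sub_bubble_le
  tendsto_const_mul_imageTail)

variable {D : ℕ} {F : Type*} [Fintype F]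

/-! ## §1 Dominated convergence on `ℤ^D` for uniformly localised families -/

section ZD

variable {A : MKer D F} {K X Y : ℕ → MKer D F} {Kinf Xinf Yinf : MKer D F} {p q p' q' : Site D} {CA δA C CX CY δ : ℝ}

/-- [folklore] **FIXED DECAYING LEG ∘ UNIFORM FAMILY**: if `K k` is bi-localised at `(p, q)` uniformly in `k` and converges entrywise to `K∞`, then
`(A ∘ K k)(x, z) → (A ∘ K∞)(x, z)` (dominated convergence over the middle point against `|F|·|C_A|·C·e^{−δ(|y−p|₁+|z−q|₁)}`). -/
theorem tendsto_comp_apply_of_uniform (hA : Decays A CA δA) (hδA : 0 < δA) (hK : ∀ k, BiLoc (K k) p q C δ) (hδ : 0 < δ)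
    (hlim : ∀ x y a b, Tendsto (fun k => K k x y a b) atTop (𝓝 (Kinf x y a b))) (x z : Site D) (a b : F) :
    Tendsto (fun k => comp A (K k) x z a b) atTop (𝓝 (comp A Kinf x z a b)) := by
  unfold ExpKernelCalculus.comp
  refine tendsto_tsum_of_dominated_convergence
    (bound := fun y => (Fintype.card F : ℝ) * (|CA| * C * Real.exp (-δ * (l1 (y - p) + l1 (z - q))))) ?_ ?_ ?_
  · have hs := (summable_exp_shift' (D := D) hδ p).mul_left ((Fintype.card F : ℝ) * (|CA| * C) * Real.exp (-δ * l1 (z - q)))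
    refine hs.congr fun y => ?_
    rw [mul_add, Real.exp_add]; ring
  · intro y
    exact tendsto_finsetSum _ fun f _ => (hlim y z f b).const_mul _
  · refine Eventually.of_forall fun k y => ?_
    calc ‖∑ f, A x y a f * K k y z f b‖ ≤ ∑ f, ‖A x y a f * K k y z f b‖ := norm_sum_le _ _
      _ ≤ ∑ _f : F, |CA| * C * Real.exp (-δ * (l1 (y - p) + l1 (z - q))) := Finset.sum_le_sum fun f _ => by
          rw [Real.norm_eq_abs, abs_mul, mul_assoc]
          exact mul_le_mul ((bdd_of_decays hA hδA.le x y a f).trans (le_abs_self CA)) (hK k y z f b) (abs_nonneg _) (abs_nonneg _)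
      _ = _ := by rw [Finset.sum_const, Finset.card_univ, nsmul_eq_mul]

/-- [folklore] **TWO UNIFORM FAMILIES**: `X k` bi-localised at `(p, p′)`, `Y k` at `(q′, q)`, both uniformly in `k` and entrywise convergent ⟹
`(X k ∘ Y k)(x, z) → (X∞ ∘ Y∞)(x, z)`. -/
theorem tendsto_comp_apply_of_uniform₂ (hX : ∀ k, BiLoc (X k) p p' CX δ) (hY : ∀ k, BiLoc (Y k) q' q CY δ) (hδ : 0 < δ)
    (hlimX : ∀ x y a b, Tendsto (fun k => X k x y a b) atTop (𝓝 (Xinf x y a b)))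
    (hlimY : ∀ x y a b, Tendsto (fun k => Y k x y a b) atTop (𝓝 (Yinf x y a b))) (x z : Site D) (a b : F) :
    Tendsto (fun k => comp (X k) (Y k) x z a b) atTop (𝓝 (comp Xinf Yinf x z a b)) := by
  classical
  have hCX : 0 ≤ CX := (hX 0).nonneg a
  have hCY : 0 ≤ CY := (hY 0).nonneg a
  unfold ExpKernelCalculus.comp
  refine tendsto_tsum_of_dominated_convergence
    (bound := fun y => (Fintype.card F : ℝ) * (CX * CY * Real.exp (-δ * (l1 (x - p) + l1 (z - q))) * Real.exp (-δ * l1 (y - p')))) ?_ ?_ ?_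
  · exact (summable_exp_shift' (D := D) hδ p').mul_left ((Fintype.card F : ℝ) * (CX * CY * Real.exp (-δ * (l1 (x - p) + l1 (z - q)))))
      |>.congr fun y => by ring
  · intro y
    exact tendsto_finsetSum _ fun f _ => (hlimX x y a f).mul (hlimY y z f b)
  · refine Eventually.of_forall fun k y => ?_
    calc ‖∑ f, X k x y a f * Y k y z f b‖ ≤ ∑ f, ‖X k x y a f * Y k y z f b‖ := norm_sum_le _ _
      _ ≤ ∑ _f : F, CX * CY * Real.exp (-δ * (l1 (x - p) + l1 (z - q))) * Real.exp (-δ * l1 (y - p')) :=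
          Finset.sum_le_sum fun f _ => by
            rw [Real.norm_eq_abs, abs_mul]
            have h1 := hX k x y a f
            have h2 := hY k y z f b
            have h3 : Real.exp (-δ * (l1 (y - q') + l1 (z - q))) ≤ Real.exp (-δ * l1 (z - q)) :=
              Real.exp_le_exp.mpr (by nlinarith [l1_nonneg (y - q')])
            have h4 : |Y k y z f b| ≤ CY * Real.exp (-δ * l1 (z - q)) := h2.trans (mul_le_mul_of_nonneg_left h3 hCY)
            calc |X k x y a f| * |Y k y z f b|
                ≤ (CX * Real.exp (-δ * (l1 (x - p) + l1 (y - p')))) * (CY * Real.exp (-δ * l1 (z - q))) :=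
                  mul_le_mul h1 h4 (abs_nonneg _) (by positivity)
              _ = CX * CY * Real.exp (-δ * (l1 (x - p) + l1 (z - q))) * Real.exp (-δ * l1 (y - p')) := by
                  rw [mul_add, Real.exp_add, mul_add, Real.exp_add]; ring
      _ = _ := by rw [Finset.sum_const, Finset.card_univ, nsmul_eq_mul]

/-- [folklore] **TRACE OF A UNIFORM FAMILY**: `K k` bi-localised at `(p, q)` uniformly, entrywise convergent ⟹ `tr (K k) → tr K∞`
(dominated convergence against `|F|·C·e^{−(δ/2)|p−q|₁}·e^{−(δ/2)|x−p|₁}`, `abs_trTerm_le`). -/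
theorem tendsto_tr_of_uniform (hK : ∀ k, BiLoc (K k) p q C δ) (hδ : 0 < δ)
    (hlim : ∀ x y a b, Tendsto (fun k => K k x y a b) atTop (𝓝 (Kinf x y a b))) :
    Tendsto (fun k => tr (K k)) atTop (𝓝 (tr Kinf)) := by
  unfold ExpKernelCalculus.tr
  refine tendsto_tsum_of_dominated_convergence
    (bound := fun x => (Fintype.card F : ℝ) * C * Real.exp (-(δ / 2) * l1 (p - q)) * Real.exp (-(δ / 2) * l1 (x - p))) ?_ ?_ ?_
  · exact (summable_exp_shift' (D := D) (half_pos hδ) p).mul_left _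
  · intro x
    exact tendsto_finsetSum _ fun a _ => hlim x x a a
  · exact Eventually.of_forall fun k x => by rw [Real.norm_eq_abs]; exact abs_trTerm_le (hK k) hδ.le x

/-- [folklore] **TADPOLE OF A UNIFORM FAMILY**: `tadpole A (W k) → tadpole A W∞`. -/
theorem tendsto_tadpole_of_uniform (hA : Decays A CA δA) (hδA : 0 < δA) (hW : ∀ k, BiLoc (K k) p q C δ) (hδ : 0 < δ)
    (hlim : ∀ x y a b, Tendsto (fun k => K k x y a b) atTop (𝓝 (Kinf x y a b))) :
    Tendsto (fun k => tadpole A (K k)) atTop (𝓝 (tadpole A Kinf)) := by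
  have hδ₀ : 0 < min δA δ := lt_min hδA hδ
  have hAW : ∀ k, BiLoc (comp A (K k)) p q ((Fintype.card F : ℝ) * (|CA| * |C|) * Zl D (min δA δ - min δA δ / 2)) (min δA δ / 2) :=
    fun k => biLoc_comp_decays (decays_of_le hA (min_le_left δA δ)) (biLoc_of_le (hW k) (min_le_right δA δ)) (half_pos hδ₀).le
      (half_lt_self hδ₀)
  unfold ExpKernelCalculus.tadpole
  exact tendsto_tr_of_uniform hAW (half_pos hδ₀) (tendsto_comp_apply_of_uniform hA hδA hW hδ hlim)

/-- [folklore] **BUBBLE OF TWO UNIFORM FAMILIES**: `bubble A (V k) (V′ k) → bubble A V∞ V′∞`. -/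
theorem tendsto_bubble_of_uniform (hA : Decays A CA δA) (hδA : 0 < δA) (hV : ∀ k, BiLoc (X k) p p' CX δ) (hV' : ∀ k, BiLoc (Y k) q' q CY δ)
    (hδ : 0 < δ) (hlimV : ∀ x y a b, Tendsto (fun k => X k x y a b) atTop (𝓝 (Xinf x y a b)))
    (hlimV' : ∀ x y a b, Tendsto (fun k => Y k x y a b) atTop (𝓝 (Yinf x y a b))) :
    Tendsto (fun k => bubble A (X k) (Y k)) atTop (𝓝 (bubble A Xinf Yinf)) := by
  have hδ₀ : 0 < min δA δ := lt_min hδA hδ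
  have hA₀ : Decays A (|CA|) (min δA δ) := decays_of_le hA (min_le_left _ _)
  have hX : ∀ k, BiLoc (comp A (X k)) p p' ((Fintype.card F : ℝ) * (|CA| * |CX|) * Zl D (min δA δ - min δA δ / 2)) (min δA δ / 2) :=
    fun k => biLoc_comp_decays hA₀ (biLoc_of_le (hV k) (min_le_right _ _)) (half_pos hδ₀).le (half_lt_self hδ₀)
  have hY : ∀ k, BiLoc (comp A (Y k)) q' q ((Fintype.card F : ℝ) * (|CA| * |CY|) * Zl D (min δA δ - min δA δ / 2)) (min δA δ / 2) :=
    fun k => biLoc_comp_decays hA₀ (biLoc_of_le (hV' k) (min_le_right _ _)) (half_pos hδ₀).le (half_lt_self hδ₀)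
  have hXY := fun k => biLoc_comp_biLoc (hX k) (hY k) (half_pos hδ₀)
  unfold ExpKernelCalculus.bubble
  exact tendsto_tr_of_uniform hXY (half_pos hδ₀)
    (tendsto_comp_apply_of_uniform₂ hX hY (half_pos hδ₀) (tendsto_comp_apply_of_uniform hA hδA hV hδ hlimV)
      (tendsto_comp_apply_of_uniform hA hδA hV' hδ hlimV'))

/-- [folklore] **`ℤ^D` HESSIAN KERNEL OF UNIFORM FAMILIES**: for k-indexed base-point families `𝒱 k`, `𝒲 k` with (u1) uniform localisation of
`𝒱 k μ 0`, `𝒱 k ν z`, `𝒲 k μ 0 ν z` and (u2) entrywise limits `𝒱∞`, `𝒲∞`: `hessKer A (𝒱 k) (𝒲 k) μ ν z → hessKer A 𝒱∞ 𝒲∞ μ ν z`. -/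
theorem tendsto_hessKer_of_uniform (hA : Decays A CA δA) (hδA : 0 < δA)
    (𝒱 : ℕ → Fin D → Site D → MKer D F) (𝒲 : ℕ → Fin D → Site D → Fin D → Site D → MKer D F)
    (𝒱inf : Fin D → Site D → MKer D F) (𝒲inf : Fin D → Site D → Fin D → Site D → MKer D F) (μ ν : Fin D) (z : Site D)
    (hV : ∀ k, BiLoc (𝒱 k μ 0) p p' CX δ) (hV' : ∀ k, BiLoc (𝒱 k ν z) q' q CY δ) (hW : ∀ k, BiLoc (𝒲 k μ 0 ν z) p q C δ) (hδ : 0 < δ)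
    (hlimV : ∀ x y a b, Tendsto (fun k => 𝒱 k μ 0 x y a b) atTop (𝓝 (𝒱inf μ 0 x y a b)))
    (hlimV' : ∀ x y a b, Tendsto (fun k => 𝒱 k ν z x y a b) atTop (𝓝 (𝒱inf ν z x y a b)))
    (hlimW : ∀ x y a b, Tendsto (fun k => 𝒲 k μ 0 ν z x y a b) atTop (𝓝 (𝒲inf μ 0 ν z x y a b))) :
    Tendsto (fun k => hessKer A (𝒱 k) (𝒲 k) μ ν z) atTop (𝓝 (hessKer A 𝒱inf 𝒲inf μ ν z)) := by
  unfold ExpKernelCalculus.hessKer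
  exact ((tendsto_tadpole_of_uniform hA hδA hW hδ hlimW).const_mul _).sub
    ((tendsto_bubble_of_uniform hA hδA hV hV' hδ hlimV hlimV').const_mul _)

end ZD

/-! ## §2 The torus limits for uniformly localised k-dependent families -/

section Torus

variable {A : MKer D F} {K X Y : ℕ → MKer D F} {Kinf Xinf Yinf : MKer D F} {p q p' q' : Site D} {CA δA C CX CY δ : ℝ}
  {σ : ℕ → ℕ} [∀ k, NeZero (σ k)]

/-- [folklore] **TADPOLE LIMIT, UNIFORM FAMILIES**: along periods `σ k → ∞` with the leg jointly `σ k`-periodic,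
`tr_{T_{σk}}(Â · (arr (σ k) (W k))^) → tadpole A W∞` (TA3's rate at the k-th family + §1). -/
theorem tendsto_trace_tadpole_of_uniform (hA : Decays A CA δA) (hδA : 0 < δA)
    (hAper : ∀ k, ∀ x y t, ∀ a b : F, A (imageShift (σ k) x t) (imageShift (σ k) y t) a b = A x y a b)
    (hW : ∀ k, BiLoc (K k) p q C δ) (hδ : 0 < δ) (hlim : ∀ x y a b, Tendsto (fun k => K k x y a b) atTop (𝓝 (Kinf x y a b)))
    (hσ : Tendsto σ atTop atTop) :
    Tendsto (fun k => Matrix.trace (Matrix.of (periodiseF (σ k) (toF A)) * Matrix.of (periodiseF (σ k) (toF (arr (σ k) (K k))))))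
      atTop (𝓝 (tadpole A Kinf)) := by
  have h0 := tendsto_const_mul_imageTail (D := D) hσ (half_pos (half_pos (lt_min hδA hδ)))
    ((Fintype.card F : ℝ) * ((Fintype.card F : ℝ) * (|CA| * |C|) * Zl D (min δA δ - min δA δ / 2)) * Zl D (min δA δ / 2 / 2) *
      Real.exp (min δA δ / 2 / 2 * l1 (p - q)))
  have h1 : Tendsto (fun k => Matrix.trace (Matrix.of (periodiseF (σ k) (toF A)) * Matrix.of (periodiseF (σ k) (toF (arr (σ k) (K k)))))
      - tadpole A (K k)) atTop (𝓝 0) :=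
    squeeze_zero_norm (fun k => by rw [Real.norm_eq_abs]; exact abs_trace_tadpole_sub_tadpole_le hA hδA (hAper k) (hW k) hδ) h0
  have h2 := tendsto_tadpole_of_uniform hA hδA hW hδ hlim
  have h := h1.add h2
  rw [zero_add] at h
  exact h.congr fun k => sub_add_cancel _ _

/-- [folklore] **BUBBLE LIMIT, UNIFORM FAMILIES**: `tr_{T_{σk}}((Â(arr (V k))^)(Â(arr (V′ k))^)) → bubble A V∞ V′∞`. -/
theorem tendsto_trace_bubble_of_uniform (hA : Decays A CA δA) (hδA : 0 < δA)
    (hAper : ∀ k, ∀ x y t, ∀ a b : F, A (imageShift (σ k) x t) (imageShift (σ k) y t) a b = A x y a b)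
    (hV : ∀ k, BiLoc (X k) p p' CX δ) (hV' : ∀ k, BiLoc (Y k) q' q CY δ) (hδ : 0 < δ)
    (hlimV : ∀ x y a b, Tendsto (fun k => X k x y a b) atTop (𝓝 (Xinf x y a b)))
    (hlimV' : ∀ x y a b, Tendsto (fun k => Y k x y a b) atTop (𝓝 (Yinf x y a b))) (hσ : Tendsto σ atTop atTop) :
    Tendsto (fun k => Matrix.trace (Matrix.of (periodiseF (σ k) (toF A)) * Matrix.of (periodiseF (σ k) (toF (arr (σ k) (X k)))) *
        (Matrix.of (periodiseF (σ k) (toF A)) * Matrix.of (periodiseF (σ k) (toF (arr (σ k) (Y k)))))))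
      atTop (𝓝 (bubble A Xinf Yinf)) := by
  have h0 := (tendsto_const_mul_imageTail (D := D) hσ (half_pos (half_pos (half_pos (half_pos (lt_min hδA hδ)))))
      ((Fintype.card F : ℝ) *
          ((Fintype.card F : ℝ) *
              ((((Fintype.card F : ℝ) * (|CA| * |CY|) * Zl D (min δA δ - min δA δ / 2)) * Zl D (min δA δ / 2 / 2) *
                  Real.exp (min δA δ / 2 / 2 * l1 (q' - q))) *
                |(Fintype.card F : ℝ) * (|CA| * |CX|) * Zl D (min δA δ - min δA δ / 2)|) *
            Zl D (min δA δ / 2 / 2 - min δA δ / 2 / 2 / 2)) *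
          Zl D (min δA δ / 2 / 2 / 2 / 2) * Real.exp (min δA δ / 2 / 2 / 2 / 2 * l1 (p - p')))).add
    (tendsto_const_mul_imageTail (D := D) hσ (half_pos (half_pos (lt_min hδA hδ)))
      ((Fintype.card F : ℝ) ^ 2 *
          (((Fintype.card F : ℝ) * (|CA| * |CX|) * Zl D (min δA δ - min δA δ / 2)) *
            ((Fintype.card F : ℝ) * (|CA| * |CY|) * Zl D (min δA δ - min δA δ / 2))) *
          Zl D (min δA δ / 2 / 2) ^ 2 * Real.exp (min δA δ / 2 / 2 * l1 (p' - q'))))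
  rw [add_zero] at h0
  have h1 : Tendsto (fun k => Matrix.trace (Matrix.of (periodiseF (σ k) (toF A)) * Matrix.of (periodiseF (σ k) (toF (arr (σ k) (X k)))) *
        (Matrix.of (periodiseF (σ k) (toF A)) * Matrix.of (periodiseF (σ k) (toF (arr (σ k) (Y k)))))) - bubble A (X k) (Y k)) atTop (𝓝 0) :=
    squeeze_zero_norm (fun k => by rw [Real.norm_eq_abs]; exact abs_trace_bubble_sub_bubble_le hA hδA (hAper k) (hV k) (hV' k) hδ) h0
  have h2 := tendsto_bubble_of_uniform hA hδA hV hV' hδ hlimV hlimV'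
  have h := h1.add h2
  rw [zero_add] at h
  exact h.congr fun k => sub_add_cancel _ _

/-- [folklore] **HESS LIMIT, UNIFORM FAMILIES — THE SOCKET OF ρ-g7-8**: for k-indexed base-point families `𝒱 k`, `𝒲 k` with
(u1) `BiLoc (𝒱 k μ 0) p p′ Cv δ`, `BiLoc (𝒱 k ν z) q′ q Cv′ δ`, `BiLoc (𝒲 k μ 0 ν z) p q C δ` UNIFORMLY in `k` and (u2) entrywise limits `𝒱∞`, `𝒲∞`,
along `σ k → ∞` with the leg jointly `σ k`-periodic:
`hessT Â (arr (𝒱 k μ 0))^ (arr (𝒱 k ν z))^ (arr (𝒲 k μ 0 ν z))^ → hessKer A 𝒱∞ 𝒲∞ μ ν z`. -/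
theorem tendsto_hessT_hessKer_of_uniform (hA : Decays A CA δA) (hδA : 0 < δA)
    (hAper : ∀ k, ∀ x y t, ∀ a b : F, A (imageShift (σ k) x t) (imageShift (σ k) y t) a b = A x y a b)
    (𝒱 : ℕ → Fin D → Site D → MKer D F) (𝒲 : ℕ → Fin D → Site D → Fin D → Site D → MKer D F)
    (𝒱inf : Fin D → Site D → MKer D F) (𝒲inf : Fin D → Site D → Fin D → Site D → MKer D F) (μ ν : Fin D) (z : Site D)
    (hV : ∀ k, BiLoc (𝒱 k μ 0) p p' CX δ) (hV' : ∀ k, BiLoc (𝒱 k ν z) q' q CY δ) (hW : ∀ k, BiLoc (𝒲 k μ 0 ν z) p q C δ) (hδ : 0 < δ)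
    (hlimV : ∀ x y a b, Tendsto (fun k => 𝒱 k μ 0 x y a b) atTop (𝓝 (𝒱inf μ 0 x y a b)))
    (hlimV' : ∀ x y a b, Tendsto (fun k => 𝒱 k ν z x y a b) atTop (𝓝 (𝒱inf ν z x y a b)))
    (hlimW : ∀ x y a b, Tendsto (fun k => 𝒲 k μ 0 ν z x y a b) atTop (𝓝 (𝒲inf μ 0 ν z x y a b)))
    (hσ : Tendsto σ atTop atTop) :
    Tendsto (fun k => hessT (Matrix.of (periodiseF (σ k) (toF A))) (Matrix.of (periodiseF (σ k) (toF (arr (σ k) (𝒱 k μ 0)))))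
        (Matrix.of (periodiseF (σ k) (toF (arr (σ k) (𝒱 k ν z))))) (Matrix.of (periodiseF (σ k) (toF (arr (σ k) (𝒲 k μ 0 ν z))))))
      atTop (𝓝 (hessKer A 𝒱inf 𝒲inf μ ν z)) := by
  have ht := tendsto_trace_tadpole_of_uniform hA hδA hAper hW hδ hlimW hσ
  have hb := tendsto_trace_bubble_of_uniform hA hδA hAper hV hV' hδ hlimV hlimV' hσ
  have h := (ht.sub hb).const_mul (1 / 2 : ℝ)
  have e : hessKer A 𝒱inf 𝒲inf μ ν z = (1 / 2 : ℝ) * (tadpole A (𝒲inf μ 0 ν z) - bubble A (𝒱inf μ 0) (𝒱inf ν z)) := by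
    simp only [hessKer]; ring
  rw [e]
  exact h.congr fun k => rfl

end Torus

end Summit.QuantumFields.BalabanUV.Beta.D1BFx.TorusArrayLimitUniform

end

-- ops-buildfix-2 2026-08-23: no-op re-land to make the build lane rebuild and re-publish this module's artefacts (hub .olean page-truncated in the 18:18Z ENOSPC incident, LEDGER B18-1).
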